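import Summits.QuantumFields.BalabanUV.T4Continuum.Spine.NE1p.B7AveragingWordCommutator

/-!
# T⁴ programme, spine estimate NE1′ (node O3b/H2) — door (c), route (ii), first brick: SIZE BOUNDS for the loops and the
# one-step average (42) along COMPLEX two-parameter rays `e^{tA}·e^{sB}` (no unit-ball hypothesis)

Cell `pub-balaban-gaps` (YM blitz Y1, track G2), seat `ne1` gen 10 (prover-pub-balaban-gaps-ne1-g10-0); record `HOME/ne/NE1.md` v10.x
R61 ∕ `HOME/pub-balaban-gaps-ne1/gen10/R61-PLAN.md` steps (ii-a)∕(ii-b).  ADDITIVE — imports this seat's `B7AveragingWordCommutator` (gen 9;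
a built module) and through it the lineages' `B7Prop1Explicit` (`hol`, `stepHol`, `Wcx`, `Xavg`, `bavg`, `expUnit`,
`norm_exp_sub_one_le_of_norm_le`, `length_gammaWord`, `l1_boxVec_le`, `norm_avg_le`), `B7Prop3Flat.expCfg`, `MatrixLog` BY NAME; 0 def.

WHY.  Route (ii) of R61 (the quadratic term at a CURVED background, «∝ non-flatness») runs Cauchy estimates in the COMPLEX parameters
`t` (slot) and `s` (background): Mathlib's `Complex.norm_iteratedDeriv_le_of_forall_mem_sphere_norm_le` needs sup bounds on complex
discs.  The lineage's size estimates ((35)∕(44)∕(47): `B7Prop2Explicit.norm_Wcx_sub_one_le`, `B7Prop1Explicit.side_estimate`) assume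
UNIT-BALL bond variables (`U1`), which `e^{tA}` violates for complex `t`.  This file supplies the replacement: crude exponential bounds
with NO hypothesis on the values beyond `‖A(b)‖ ≤ a`, `‖B(b)‖ ≤ b`.

WHAT THIS FILE PROVES ([folklore]; 0 sorry).  For bond fields `A, B` on `ℤᵈ` with `‖A(b)‖ ≤ a`, `‖B(b)‖ ≤ b`, all `s t : ℂ`,
`c := ‖t‖a + ‖s‖b`:
* `norm_mul_sub_one_le_exp` — `‖g − 1‖ ≤ eᵖ − 1`, `‖h − 1‖ ≤ e^q − 1` ⇒ `‖gh − 1‖ ≤ e^{p+q} − 1`;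
* `norm_stepHol_ray_sub_one_le` — one letter of (9): `‖(e^{tA}e^{sB})(±b) − 1‖ ≤ e^{c} − 1` (the reversed letter is `e^{−sB}e^{−tA}`);
* `norm_hol_ray_sub_one_le` — words: `‖(e^{tA}e^{sB})(Γ) − 1‖ ≤ e^{|Γ|·c} − 1`;
* `norm_Wcx_ray_sub_one_le` — the loops of (42): `≤ e^{(2dL+2L)·c} − 1`; `norm_Wcx_ray_sub_one_lt` — `< 1∕4` once `(2dL+2L)·c ≤ 1∕5`
  (`Real.abs_exp_sub_one_sub_id_le`): inside the radius of (21), uniformly on the polydisc `‖t‖ ≤ ρ, ‖s‖ ≤ R` with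
  `(2dL+2L)(ρa + Rb) ≤ 1∕5` — the radii of R61-PLAN (ii-b);
* `norm_Xavg_ray_le` — the exponent of (42): `‖X_c(e^{tA}e^{sB})‖ ≤ 2(e^{(2dL+2L)c} − 1)` there ((21): `‖log W‖ ≤ 2‖W − 1‖`).
What it does NOT do: the joint analyticity (ii-c), the Cauchy bounds (ii-d), the statement (∗) of R61-PLAN — successor work.

HONEST FRAMING.  [folklore] bookkeeping; nothing of Bałaban's asserted; NE1′ NOT proved; spine 0∕9; (B) 0∕13; binders 0∕6; one fixed
finite T⁴ — NOT ℝ⁴, NOT infinite volume, NOT a mass gap, NOT Clay.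
-/

noncomputable section

open scoped Topology
open NormedSpace Filter

namespace Summit.QuantumFields.BalabanUV.T4Continuum.NE1p.B7AveragingCommutator

open Literature.MathematicalPhysics.QuantumFieldTheory.Balaban1983to89.MatrixLog (mlog)
open Literature.MathematicalPhysics.QuantumFieldTheory.Balaban1983to89.B7Prop1Explicit
open Literature.MathematicalPhysics.QuantumFieldTheory.Balaban1983to89.B7Prop3Flat (expCfg)

variable {𝔸 : Type*} [NormedRing 𝔸] [NormedAlgebra ℂ 𝔸] [CompleteSpace 𝔸]

omit [NormedAlgebra ℂ 𝔸] [CompleteSpace 𝔸] in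
/-- Products: `‖g − 1‖ ≤ eᵖ − 1` and `‖h − 1‖ ≤ e^q − 1` give `‖gh − 1‖ ≤ e^{p+q} − 1` (`gh − 1 = (g−1)(h−1) + (g−1) + (h−1)`).
[folklore] -/
theorem norm_mul_sub_one_le_exp {g h : 𝔸} {p q : ℝ} (hg : ‖g - 1‖ ≤ Real.exp p - 1) (hh : ‖h - 1‖ ≤ Real.exp q - 1) :
    ‖g * h - 1‖ ≤ Real.exp (p + q) - 1 := by
  have e : g * h - 1 = (g - 1) * (h - 1) + (g - 1) + (h - 1) := by noncomm_ring
  have hp : 0 ≤ Real.exp p - 1 := (norm_nonneg _).trans hg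
  rw [e]
  calc ‖(g - 1) * (h - 1) + (g - 1) + (h - 1)‖ ≤ ‖(g - 1) * (h - 1)‖ + ‖g - 1‖ + ‖h - 1‖ := norm_add₃_le
    _ ≤ ‖g - 1‖ * ‖h - 1‖ + ‖g - 1‖ + ‖h - 1‖ := by gcongr; exact norm_mul_le _ _
    _ ≤ (Real.exp p - 1) * (Real.exp q - 1) + (Real.exp p - 1) + (Real.exp q - 1) :=
        add_le_add (add_le_add (mul_le_mul hg hh (norm_nonneg _) hp) hg) hh
    _ = Real.exp (p + q) - 1 := by rw [Real.exp_add]; ring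

/-- One exponential factor: `‖t • X‖ ≤ ‖t‖·a` for `‖X‖ ≤ a`, hence `‖e^{tX} − 1‖ ≤ e^{‖t‖a} − 1`. [folklore] -/
theorem norm_exp_smul_sub_one_le {X : 𝔸} {a : ℝ} (hX : ‖X‖ ≤ a) (t : ℂ) :
    ‖exp (t • X) - 1‖ ≤ Real.exp (‖t‖ * a) - 1 :=
  (norm_exp_sub_one_le_of_norm_le ((norm_smul_le t X).trans (mul_le_mul_of_nonneg_left hX (norm_nonneg t)))).1

section Ray

variable {d : ℕ} {A B : Site d → Fin d → 𝔸} {a b : ℝ}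
  (ha : ∀ (y : Site d) (μ : Fin d), ‖A y μ‖ ≤ a) (hb : ∀ (y : Site d) (μ : Fin d), ‖B y μ‖ ≤ b)

include ha hb

/-- **One letter of (9) along the complex ray**: `‖(e^{tA}e^{sB})(±b) − 1‖ ≤ e^{‖t‖a + ‖s‖b} − 1` — for `+b` the bond variable is
`e^{tA(b)}e^{sB(b)}`, for `−b` its inverse `e^{−sB(b)}e^{−tA(b)}`; no unit-ball hypothesis, `s, t` complex.
[cite: Balaban1985Averaging, (9) p.18] -/
theorem norm_stepHol_ray_sub_one_le (s t : ℂ) (x : Site d) (l : Letter d) :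
    ‖((stepHol (expCfg (t • A) * expCfg (s • B)) x l : 𝔸ˣ) : 𝔸) - 1‖ ≤ Real.exp (‖t‖ * a + ‖s‖ * b) - 1 := by
  obtain ⟨μ, c⟩ := l
  cases c
  · rw [stepHol_false]
    have e1 : ((expCfg (t • A) * expCfg (s • B)) (x - e μ) μ)⁻¹
        = (expUnit ((s • B) (x - e μ) μ))⁻¹ * (expUnit ((t • A) (x - e μ) μ))⁻¹ := by
      rw [Pi.mul_apply, Pi.mul_apply, mul_inv_rev]; rfl
    rw [e1, Units.val_mul, val_inv_expUnit, val_inv_expUnit, val_expUnit, val_expUnit, Pi.smul_apply, Pi.smul_apply,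
      Pi.smul_apply, Pi.smul_apply, ← smul_neg, ← smul_neg, add_comm]
    exact norm_mul_sub_one_le_exp (norm_exp_smul_sub_one_le (by rw [norm_neg]; exact hb _ _) s)
      (norm_exp_smul_sub_one_le (by rw [norm_neg]; exact ha _ _) t)
  · rw [stepHol_true]
    have e1 : (expCfg (t • A) * expCfg (s • B)) x μ = expUnit ((t • A) x μ) * expUnit ((s • B) x μ) := by
      rw [Pi.mul_apply, Pi.mul_apply]; rfl
    rw [e1, Units.val_mul, val_expUnit, val_expUnit, Pi.smul_apply, Pi.smul_apply, Pi.smul_apply, Pi.smul_apply]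
    exact norm_mul_sub_one_le_exp (norm_exp_smul_sub_one_le (ha _ _) t) (norm_exp_smul_sub_one_le (hb _ _) s)

/-- **Words along the complex ray**: `‖(e^{tA}e^{sB})(Γ) − 1‖ ≤ e^{|Γ|(‖t‖a + ‖s‖b)} − 1` (induction on the word with the product
bound). [cite: Balaban1985Averaging, (9) p.18] -/
theorem norm_hol_ray_sub_one_le (s t : ℂ) :
    ∀ (w : List (Letter d)) (x : Site d),
      ‖((hol (expCfg (t • A) * expCfg (s • B)) x w : 𝔸ˣ) : 𝔸) - 1‖ ≤ Real.exp (w.length * (‖t‖ * a + ‖s‖ * b)) - 1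
  | [], x => by simp
  | l :: w, x => by
    rw [hol_cons, Units.val_mul, List.length_cons]
    have h := norm_mul_sub_one_le_exp (norm_stepHol_ray_sub_one_le ha hb s t x l) (norm_hol_ray_sub_one_le s t w (x + l.vec))
    have e : ‖t‖ * a + ‖s‖ * b + w.length * (‖t‖ * a + ‖s‖ * b) = ((w.length + 1 : ℕ) : ℝ) * (‖t‖ * a + ‖s‖ * b) := by
      push_cast; ring
    rwa [e] at h

/-- **The loop variables of (42) along the complex ray**: `‖(e^{tA}e^{sB})(Γ_{c,x} ∪ (−Γ_c)) − 1‖ ≤ e^{(2dL+2L)(‖t‖a + ‖s‖b)} − 1`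
(the loop has at most `2dL + 2L` letters; `a, b ≥ 0`). [cite: Balaban1985Averaging, (42) p.23, (14) p.19] -/
theorem norm_Wcx_ray_sub_one_le (hann : 0 ≤ a) (hbnn : 0 ≤ b) (L : ℕ) (s t : ℂ) (q : Site d) (κ : Fin d)
    (r : Fin d → Fin L) :
    ‖((Wcx L (expCfg (t • A) * expCfg (s • B)) q κ (boxVec L r) : 𝔸ˣ) : 𝔸) - 1‖
      ≤ Real.exp ((2 * d * L + 2 * L) * (‖t‖ * a + ‖s‖ * b)) - 1 := by
  rw [Wcx_eq_hol_loop]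
  refine (norm_hol_ray_sub_one_le ha hb s t _ q).trans ?_
  have hc : 0 ≤ ‖t‖ * a + ‖s‖ * b := by positivity
  have hlen : ((gammaWord L κ (boxVec L r) ++ seg κ (-(L : ℤ))).length : ℝ) ≤ 2 * d * L + 2 * L := by
    have h1 : (l1 (boxVec L r) : ℝ) ≤ d * L := by exact_mod_cast l1_boxVec_le L r
    rw [List.length_append, length_gammaWord, length_seg, Int.natAbs_neg, Int.natAbs_natCast]
    push_cast
    linarith
  gcongr

/-- **Inside the radius of (21), uniformly on a polydisc**: if `(2dL+2L)(‖t‖a + ‖s‖b) ≤ 1∕5` then every loop variable of the block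
satisfies `‖(e^{tA}e^{sB})(Γ_{c,x} ∪ (−Γ_c)) − 1‖ < 1∕4` (`e^{1∕5} − 1 ≤ 1∕5 + 1∕25 < 1∕4`) — in particular for `‖t‖ ≤ ρ`,
`‖s‖ ≤ R` with `(2dL+2L)(ρa + Rb) ≤ 1∕5`: the radii of R61-PLAN (ii-b). [cite: Balaban1985Averaging, (21) p.21, (42) p.23] -/
theorem norm_Wcx_ray_sub_one_lt (hann : 0 ≤ a) (hbnn : 0 ≤ b) (L : ℕ) (s t : ℂ)
    (h : (2 * d * L + 2 * L) * (‖t‖ * a + ‖s‖ * b) ≤ 1 / 5) (q : Site d) (κ : Fin d) (r : Fin d → Fin L) :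
    ‖((Wcx L (expCfg (t • A) * expCfg (s • B)) q κ (boxVec L r) : 𝔸ˣ) : 𝔸) - 1‖ < 1 / 4 := by
  refine (norm_Wcx_ray_sub_one_le ha hb hann hbnn L s t q κ r).trans_lt ?_
  set x : ℝ := (2 * d * L + 2 * L) * (‖t‖ * a + ‖s‖ * b) with hx
  have hx0 : 0 ≤ x := by positivity
  have hx1 : |x| ≤ 1 := by rw [abs_of_nonneg hx0]; linarith
  have hexp := Real.abs_exp_sub_one_sub_id_le hx1
  have h2 : Real.exp x - 1 - x ≤ x ^ 2 := (le_abs_self _).trans hexp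
  nlinarith [h, hx0]

/-- **The exponent of (42) along the complex ray**: inside the polydisc of the previous theorem,
`‖X_c(e^{tA}e^{sB})‖ ≤ 2·(e^{(2dL+2L)(‖t‖a + ‖s‖b)} − 1)` ((21): `‖log W‖ ≤ 2‖W − 1‖` for `‖W − 1‖ ≤ 1∕2`; the weights `L^{−d}` sum
to `1`, `L ≥ 1`). [cite: Balaban1985Averaging, (21) p.21, (42) p.23] -/
theorem norm_Xavg_ray_le (hann : 0 ≤ a) (hbnn : 0 ≤ b) (L : ℕ) (hL : 1 ≤ L) (s t : ℂ)
    (h : (2 * d * L + 2 * L) * (‖t‖ * a + ‖s‖ * b) ≤ 1 / 5) (q : Site d) (κ : Fin d) :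
    ‖Xavg L (expCfg (t • A) * expCfg (s • B)) q κ‖ ≤ 2 * (Real.exp ((2 * d * L + 2 * L) * (‖t‖ * a + ‖s‖ * b)) - 1) := by
  unfold Xavg
  refine norm_avg_le L hL _ fun r => ?_
  have hW := norm_Wcx_ray_sub_one_le ha hb hann hbnn L s t q κ r
  have hW' : ‖((Wcx L (expCfg (t • A) * expCfg (s • B)) q κ (boxVec L r) : 𝔸ˣ) : 𝔸) - 1‖ ≤ 1 / 2 :=
    (norm_Wcx_ray_sub_one_lt ha hb hann hbnn L s t h q κ r).le.trans (by norm_num)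
  exact (Literature.MathematicalPhysics.QuantumFieldTheory.Balaban1983to89.MatrixLog.norm_mlog_le_two_mul hW').trans
    (by linarith)

end Ray

end Summit.QuantumFields.BalabanUV.T4Continuum.NE1p.B7AveragingCommutator

end
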